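import Literature.Analysis.FluidPDE.TaoAveragedCascadeSteps
import Literature.Analysis.FluidPDE.TaoAveragedNondegeneracy
import HarnessLib

/-!
# Tao 2016, §3.2–§3.4 with the base triple as a parameter: admissible base triples, profiles
# normalised about them, and the single-scale target `B_{η,ρ,0}` of (3.9) about an arbitrary triple

Analysis/FluidPDE DEFINITIONS file (four definitions, five consistency lemmas proved; NO named fact,
NO unproven statement), sequel of `TaoAveragedCascadeSteps.lean` /
`TaoAveragedCascadeReduction.lean` (Tao's complexified cascade operators, the normalisation (3.7)
`xi0`, the weights `η`, `ρ`, the single-scale forms `B_{η,ρ,n}` and the notion of a complex average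
without dilation operators) and companion of `TaoAveragedIsoscelesDegeneracy.lean` (the coefficient
lemmas behind the non-degeneracy (3.24) off the isosceles locus). T. Tao, *Finite time blowup for an
averaged three-dimensional Navier–Stokes equation*, J. Amer. Math. Soc. **29** (2016), 601–674 =
arXiv:1402.0290v3 (held as `paper:arxiv-1402.0290`; page numbers of that text). HONEST FRAMING:
definitions about Tao's AVERAGED equation (a model); nothing is asserted beyond definitional
consistency lemmas; nothing in this file concerns the true Navier–Stokes equations.

What the source says. The dilation-free single-scale representation (3.9) — "`C₀` is a complex average
of `B_{η,ρ,0}` (without the use of dilation operators)" (§3.4, p. 16) — is proved in §3.5–§3.9 for the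
FIXED normalisation (3.7) of the base frequencies (`xi0`, magnitudes `1, √2, 1`), the dilation
averaging having been used in §3.2 exactly to reach that normalisation: "it is necessary to ensure that
`ξ⁰₁, ξ⁰₂, ξ⁰₃` have distinct magnitudes in order to avoid a certain degeneracy later in the argument
(namely, the failure of (c-nondeg) below)" (§3.2, p. 15); "In an earlier version of this manuscript, no
averaging over dilations was assumed, but it was pointed out to us by the referee that the
non-degeneracy condition (c-nondeg) failed if one did not introduce dilation averaging" (§1, footnote,
p. 6); "The averaging over dilation operators was only needed to place the base frequencies
`ξ⁰₁, ξ⁰₂, ξ⁰₃` in a location where the non-degeneracy condition (c-nondeg) held. This condition in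
fact holds for generic `ξ⁰₁, ξ⁰₂, ξ⁰₃`" (Remark 3.5, p. 20). The tree's `TaoAveragedIsoscelesDegeneracy`
makes "generic" precise at the level of the coefficients: (3.24) holds for every non-degenerate closed
triangle exactly off the isosceles locus `‖ξ⁰₁‖ = ‖ξ⁰₂‖` (the two INPUT moduli).

What this file records. The sentence (3.9) with the base triple a PARAMETER:
* `AdmissibleTriple ξ` — closed triangle `ξ 0 + ξ 1 + ξ 2 = 0`, moduli in `[½, 2]`, the two INPUT
  moduli distinct, non-collinear (the complement of the degeneracy above; the input/output modulus may
  coincide — Tao's own `xi0` has `‖ξ⁰₁‖ = ‖ξ⁰₃‖ = 1`);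
* `NormalisedProfilesAt ξ ε₀ ψ` — `ψ̂ⱼ ⊆ B(ξ j, ε₀³)` (the tree's `NormalisedProfiles` at `xi0`);
* `etaAt ξ ε₀`, `betaRhoZeroFormAt ξ ε₀` — the comparability weight `η` of §3.3 and the single-scale
  target `B_{η,ρ,0}` of (3.9) with `xi0` replaced by `ξ` in both cut-offs (the tree's `eta`,
  `betaRhoZeroForm` at `xi0`);
* consistency with the tree AT `xi0` (all proved, definitional): `normalisedProfilesAt_xi0`,
  `etaAt_xi0`, `betaRhoZeroFormAt_xi0`, `admissibleTriple_xi0` (magnitudes `1, √2, 1`: inputs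
  `1 ≠ √2`), `singleScaleAt_isComplexAverageNoDil_xi0_iff` (the dilation-free single-scale sentence
  (3.9) written with the parametrised objects AT `xi0` is literally the tree's named fact
  `singleScale_isComplexAverageNoDil`, §3.5–§3.9 — Tao's Theorem 3.2 route).

Context (one sentence): these definitions were first written for the NS-cut's averaged-equation
model ladder (harvest/h2, 2026-08-23, pub-ns-dss lead; kernel-checked outside the tree as
`LOneShape.lean`) and are re-homed here because they concern the printed operators only.

Design. No new analysis objects: everything is assembled from `HasBallFourierSupport`, `freqCutoff`,
`Λ`, `fourierFn`, `singleScaleForm`, `IsComplexAverageNoDilOf` of the two imported files; the `xi0`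
lemmas pin the parametrised objects to the tree's by `rfl` / `Iff.rfl`. Deliberately NOT here: the
parametrised sentence (3.9) ITSELF for a general admissible triple («for every admissible `ξ` there is
`ε₁(ξ) > 0` below which `C₀` is a complex average of `B_{η,ρ,0}` about `ξ` without dilation
operators», and its uniform-threshold variant) — the source does NOT prove it: Remark 3.5 (p. 20)
continues "… and so even without the use of averaging over dilations it should be the case that most
local cascade operators are expressible as averaged Euler operators. … We will however not pursue this
matter here", so that statement is an OBLIGATION to be recorded on the Summits side, not a Literature
fact; also not here: any threshold value, any claim about which triples the §3.6–§3.8 constants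
tolerate, any dynamics.

## References

* T. Tao, J. Amer. Math. Soc. 29 (2016), 601–674, arXiv:1402.0290v3: §1 footnote p. 6; §3.2 (3.7)
  and p. 15; §3.3 p. 16; §3.4 (3.8), (3.9) p. 16; §3.5–§3.9 (3.13)–(3.24); Remark 3.5 p. 20.
  Key `Tao2016AveragedNS`.
-/

noncomputable section

open MeasureTheory Set Filter FourierTransform
open scoped ENNReal NNReal SchwartzMap ComplexConjugate RealInnerProductSpace

namespace Literature.Analysis.FluidPDE.Tao2016

/-- Local notation for physical / frequency space `ℝ³`. -/
local notation "ℝ³" => EuclideanSpace ℝ (Fin 3)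
/-- Local notation for the complexified range `ℂ³`. -/
local notation "ℂ³" => EuclideanSpace ℂ (Fin 3)

/-- **Admissible base triples** for the dilation-free single-scale representation: a closed
triangle `ξ 0 + ξ 1 + ξ 2 = 0` (Tao's (3.7'), "convenient for technical reasons"), moduli
comparable to `1` (`½ ≤ ‖ξ j‖ ≤ 2`), the two INPUT moduli distinct (`‖ξ 0‖ ≠ ‖ξ 1‖` — "it is necessary
to ensure that `ξ⁰₁, ξ⁰₂, ξ⁰₃` have distinct magnitudes in order to avoid … the failure of (c-nondeg)",
§3.2 p. 15; only the input pair matters, cf. `cSigma_eq_zero_of_isosceles` /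
`cSigma_ne_zero_of_triangle`), and non-collinear (`ξ 0 × ξ 1 ≠ 0`). The complement of the isosceles
degeneracy is what Remark 3.5 (p. 20) calls "generic `ξ⁰₁, ξ⁰₂, ξ⁰₃`".
[cite: Tao2016AveragedNS, §3.2 p. 15 and Remark 3.5 p. 20] -/
def AdmissibleTriple (ξ : Fin 3 → ℝ³) : Prop :=
  ξ 0 + ξ 1 + ξ 2 = 0 ∧ (∀ j, 1 / 2 ≤ ‖ξ j‖ ∧ ‖ξ j‖ ≤ 2) ∧ ‖ξ 0‖ ≠ ‖ξ 1‖ ∧ cross (ξ 0) (ξ 1) ≠ 0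

/-- **Normalised profiles about an arbitrary base triple** (§3.2 with `xi0` replaced by `ξ`): three
complex Schwartz fields with `ψ̂ⱼ` supported in the closed ball `B(ξ j, ε₀³)`. At `ξ = xi0` this is
the tree's `NormalisedProfiles` (`normalisedProfilesAt_xi0`). [cite: Tao2016AveragedNS, §3.2 pp. 15–16] -/
def NormalisedProfilesAt (ξ : Fin 3 → ℝ³) (ε₀ : ℝ) (ψ : Fin 3 → 𝓢(ℝ³, ℂ³)) : Prop :=
  ∀ j, HasBallFourierSupport (ξ j) (ε₀ ^ 3) (ψ j)

/-- **The frequency-comparability weight `η` of §3.3 with the ratios of an arbitrary base triple**: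
`η(N₁,N₂,N₃) = Π_{j=2,3} φ((N_j/N₁ − ‖ξ j‖/‖ξ 0‖)/(10 ε₀²))` (Tao's `η` has the ratios of `xi0`;
`etaAt_xi0`). [cite: Tao2016AveragedNS, §3.3 p. 16] -/
def etaAt (ξ : Fin 3 → ℝ³) (ε₀ : ℝ) (N₁ N₂ N₃ : ℝ) : ℝ :=
  freqCutoff ((N₂ / N₁ - ‖ξ 1‖ / ‖ξ 0‖) / (10 * ε₀ ^ 2)) *
    freqCutoff ((N₃ / N₁ - ‖ξ 2‖ / ‖ξ 0‖) / (10 * ε₀ ^ 2))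

/-- **The single-scale target `B_{η,ρ,0}` of (3.9) about an arbitrary base triple**:
`⟨B_{η,ρ,0}(u,v), w⟩ = ∫_{ξ₁+ξ₂+ξ₃=0} φ(‖ξ₁ − ξ 0‖/ε₀²) η(‖ξ₁‖,‖ξ₂‖,‖ξ₃‖) Λ(û(ξ₁), v̂(ξ₂), ŵ(ξ₃))`
with the `ρ`-cut-off centred at `ξ 0` and the `η`-cut-off at the triple's modulus ratios (Tao's
`B_{η,ρ,0}` is the `xi0` instance: `betaRhoZeroFormAt_xi0`). Bochner junk `0`.
[cite: Tao2016AveragedNS, §3.4 (3.9) p. 16] -/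
def betaRhoZeroFormAt (ξ : Fin 3 → ℝ³) (ε₀ : ℝ) (u v w : L2C) : ℂ :=
  ∫ p : ℝ³ × ℝ³,
    ((freqCutoff (‖p.1 - ξ 0‖ / ε₀ ^ 2) * etaAt ξ ε₀ ‖p.1‖ ‖p.2‖ ‖-p.1 - p.2‖ : ℝ) : ℂ) *
      Λ p.1 p.2 (fourierFn u p.1) (fourierFn v p.2) (fourierFn w (-p.1 - p.2))

/-! ### Consistency with the tree at Tao's normalisation `xi0` -/

/-- At `ξ = xi0` the parametrised normalisation is the tree's `NormalisedProfiles` (by `Iff.rfl`).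
[cite: Tao2016AveragedNS, §3.2 (3.7)] -/
theorem normalisedProfilesAt_xi0 (ε₀ : ℝ) (ψ : Fin 3 → 𝓢(ℝ³, ℂ³)) :
    NormalisedProfilesAt xi0 ε₀ ψ ↔ NormalisedProfiles ε₀ ψ := Iff.rfl

/-- At `ξ = xi0` the parametrised weight is Tao's `η` (by `rfl`). [cite: Tao2016AveragedNS, §3.3 p. 16] -/
theorem etaAt_xi0 (ε₀ : ℝ) : etaAt xi0 ε₀ = eta ε₀ := rfl

/-- At `ξ = xi0` the parametrised single-scale target is Tao's `B_{η,ρ,0}` (unfold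
`betaRhoZeroForm_eq`). [cite: Tao2016AveragedNS, §3.4 (3.9) p. 16] -/
theorem betaRhoZeroFormAt_xi0 (ε₀ : ℝ) : betaRhoZeroFormAt xi0 ε₀ = betaRhoZeroForm ε₀ := by
  funext u v w
  rw [betaRhoZeroForm_eq]
  rfl

/-- **Tao's own normalisation (3.7) is admissible**: magnitudes `1, √2, 1`, so the two input moduli
`1 ≠ √2` differ (input/output equality `‖ξ⁰₁‖ = ‖ξ⁰₃‖ = 1` is harmless), the triangle closes
(`xi0_sum`) and `ξ⁰₁ × ξ⁰₂ = (0,0,1) ≠ 0`. [cite: Tao2016AveragedNS, §3.2 (3.7)] -/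
theorem admissibleTriple_xi0 : AdmissibleTriple xi0 := by
  have h0 : ‖xi0 0‖ = 1 := by
    simp [xi0, EuclideanSpace.norm_eq, Fin.sum_univ_three]
  have h1 : ‖xi0 1‖ = Real.sqrt 2 := by
    simp [xi0, EuclideanSpace.norm_eq, Fin.sum_univ_three]
    norm_num
  have h2 : ‖xi0 2‖ = 1 := by
    simp [xi0, EuclideanSpace.norm_eq, Fin.sum_univ_three]
  have hs1 : (1 : ℝ) < Real.sqrt 2 := by
    rw [show (1 : ℝ) = Real.sqrt 1 by simp]
    exact Real.sqrt_lt_sqrt (by norm_num) (by norm_num)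
  have hs2 : Real.sqrt 2 ≤ 2 := by
    rw [show (2 : ℝ) = Real.sqrt 4 by rw [show (4 : ℝ) = 2 ^ 2 by norm_num, Real.sqrt_sq (by norm_num)]]
    exact Real.sqrt_le_sqrt (by norm_num)
  refine ⟨xi0_sum, ?_, ?_, ?_⟩
  · intro j
    fin_cases j
    · simp only [Fin.zero_eta, h0]; norm_num
    · simp only [Fin.mk_one, h1]; constructor <;> linarith
    · simp only [Fin.reduceFinMk, h2]; norm_num
  · rw [h0, h1]; exact ne_of_lt hs1
  · intro h
    have := congrArg (fun v : EuclideanSpace ℝ (Fin 3) => v 2) h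
    simp [xi0, cross_apply_two] at this

/-- **The dilation-free single-scale sentence (3.9), written with the parametrised objects AT `xi0`,
is exactly the tree's named fact `singleScale_isComplexAverageNoDil`** (Tao's Theorem 3.2 route,
§3.5–§3.9): unfolding `normalisedProfilesAt_xi0` and `betaRhoZeroFormAt_xi0`. (The same sentence for a
general admissible triple is NOT proved in the source and is deliberately not declared in this file.)
[cite: Tao2016AveragedNS, §3.5–3.9 (3.9)–(3.24)] -/
theorem singleScaleAt_isComplexAverageNoDil_xi0_iff :
    (∃ ε₁ : ℝ, 0 < ε₁ ∧ ∀ ε₀ : ℝ, 0 < ε₀ → ε₀ ≤ ε₁ →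
      ∀ ψ : Fin 3 → 𝓢(ℝ³, ℂ³), NormalisedProfilesAt xi0 ε₀ ψ →
        IsComplexAverageNoDilOf (singleScaleForm (ψ 0) (ψ 1) (ψ 2)) (betaRhoZeroFormAt xi0 ε₀)) ↔
    singleScale_isComplexAverageNoDil := by
  simp only [singleScale_isComplexAverageNoDil, normalisedProfilesAt_xi0, betaRhoZeroFormAt_xi0]

/-! ### Non-vacuity of the profile classes (the `∀ ψ` of (3.9) does not close vacuously) -/

/-- **Profiles with Fourier support in a prescribed ball exist and are not trivial** (§3.2: "`ψ̂ⱼ`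
supported on the ball `B(ξⱼ⁰, ε₀³)`"): for every centre `ξ₀` and radius `r > 0` there is a complex
Schwartz field `ψ` with `ψ̂ ⊆ B(ξ₀, r)` and `ψ̂(ξ₀) ≠ 0` — the inverse Fourier transform of a smooth
bump at `ξ₀` times a fixed non-zero vector. [cite: Tao2016AveragedNS, §3.2 p. 15] -/
theorem exists_hasBallFourierSupport_fourier_ne_zero (ξ₀ : ℝ³) {r : ℝ} (hr : 0 < r) :
    ∃ ψ : 𝓢(ℝ³, ℂ³), HasBallFourierSupport ξ₀ r ψ ∧ 𝓕 (⇑ψ) ξ₀ ≠ 0 := by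
  let χ : ContDiffBump ξ₀ := ⟨r / 4, r / 2, by positivity, by linarith⟩
  let v : ℂ³ := EuclideanSpace.single 0 1
  let F : ℝ³ → ℂ³ := fun ξ => ((χ ξ : ℝ) : ℂ) • v
  have hFs : ContDiff ℝ ((⊤ : ℕ∞) : WithTop ℕ∞) F :=
    (Complex.ofRealCLM.contDiff.comp χ.contDiff).smul contDiff_const
  have hFc : HasCompactSupport F :=
    (χ.hasCompactSupport.comp_left (g := fun t : ℝ => (t : ℂ)) Complex.ofReal_zero).smul_right
  let Φ : 𝓢(ℝ³, ℂ³) := hFc.toSchwartzMap hFs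
  have hΦ : ∀ ξ, Φ ξ = F ξ := fun _ => rfl
  have hv : v ≠ 0 := by
    intro h
    have := congrArg (fun w : ℂ³ => w 0) h
    simp [v] at this
  refine ⟨𝓕⁻ Φ, fun ξ hξ => ?_, ?_⟩
  · rw [← SchwartzMap.fourier_coe, fourier_fourierInv_eq, hΦ]
    have h0 : χ ξ = 0 := χ.zero_of_le_dist (by change r / 2 ≤ dist ξ ξ₀; linarith)
    simp [F, h0]
  · rw [← SchwartzMap.fourier_coe, fourier_fourierInv_eq, hΦ]
    have h1 : χ ξ₀ = 1 :=
      χ.one_of_mem_closedBall (Metric.mem_closedBall_self (by change 0 ≤ r / 4; positivity))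
    simpa [F, h1] using hv

/-- A profile with `ψ̂(ξ₀) ≠ 0` is not the zero field. [cite: Tao2016AveragedNS, §3.2 p. 15] -/
theorem ne_zero_of_fourier_ne_zero {ψ : 𝓢(ℝ³, ℂ³)} {ξ₀ : ℝ³} (h : 𝓕 (⇑ψ) ξ₀ ≠ 0) : ψ ≠ 0 := by
  rintro rfl
  apply h
  rw [← SchwartzMap.fourier_coe, FourierTransform.fourier_zero]
  rfl

/-- **Non-vacuity of `HasBallFourierSupport`**: for `r > 0` there is a NON-ZERO complex Schwartz field
with Fourier support in `B(ξ₀, r)` (referee ask E1 of the cell harvest/h2: the profile hypotheses of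
the dilation-free representation sentences are satisfiable by non-trivial fields).
[cite: Tao2016AveragedNS, §3.2 p. 15] -/
theorem exists_ne_zero_hasBallFourierSupport (ξ₀ : ℝ³) {r : ℝ} (hr : 0 < r) :
    ∃ ψ : 𝓢(ℝ³, ℂ³), ψ ≠ 0 ∧ HasBallFourierSupport ξ₀ r ψ := by
  obtain ⟨ψ, hψ, hne⟩ := exists_hasBallFourierSupport_fourier_ne_zero ξ₀ hr
  exact ⟨ψ, ne_zero_of_fourier_ne_zero hne, hψ⟩

/-- **Non-vacuity of `NormalisedProfilesAt`** (and of the tree's `NormalisedProfiles` at `xi0`): for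
every base triple `ξ` and every `ε₀ > 0` there are profiles normalised about `ξ` with every
`ψ̂ⱼ(ξ j) ≠ 0`, in particular every `ψ j ≠ 0`. [cite: Tao2016AveragedNS, §3.2 (3.7) pp. 15–16] -/
theorem exists_normalisedProfilesAt_ne_zero (ξ : Fin 3 → ℝ³) {ε₀ : ℝ} (hε₀ : 0 < ε₀) :
    ∃ ψ : Fin 3 → 𝓢(ℝ³, ℂ³), NormalisedProfilesAt ξ ε₀ ψ ∧ ∀ j, 𝓕 (⇑(ψ j)) (ξ j) ≠ 0 ∧ ψ j ≠ 0 := by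
  choose ψ hψ hne using fun j => exists_hasBallFourierSupport_fourier_ne_zero (ξ j) (pow_pos hε₀ 3)
  exact ⟨ψ, hψ, fun j => ⟨hne j, ne_zero_of_fourier_ne_zero (hne j)⟩⟩

end Literature.Analysis.FluidPDE.Tao2016
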